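import Summits.QuantumFields.BalabanUV.T4Continuum.Support.ScalarBlockPoincare

/-!
# `BalabanUV.T4Continuum.Support.DirichletDirectionalBesov` — NE2 (node U1a) formalisation swarm, SUPPLIER item «Δ1-BESOV» under the
# owner's sub-row `T4-U1a.S-NE2-D1-DIRICHLET°` (wall `hinj`): THE ONE-SIDED NIRENBERG TRANSLATION ESTIMATE — DIRECTIONAL `H^{3/2}`
# (BESOV `B^{1/2}_{2,∞}` OF THE GRADIENT) REGULARITY UP TO THE BOUNDARY OF A LATTICE FIELD SUPPORTED IN A REGION, GIVEN AN ADMISSIBLE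
# SMOOTH DIRECTIONAL CUTOFF (unit b2b-balaban-t4-ne2-formalise-leaf-08, gen 3, module (I) file 1 of 2, v1: the toolkit, the identity and the admissible-translation
# MAIN LEMMA; file 2 `DirichletDirectionalBesovCutoff` = the smooth cutoffs and the END)

HONEST FRAMING.  Rung (B)+1 bookkeeping at MODEL level (U = 1, scalar lattice Laplacian), finite torus; NE2 (U1a) is NOT proved by this
file; spine PROVED 0/9 unchanged; NOT infinite volume, NOT the mass gap, NOT Clay.  HONEST DEPENDENCY (verbatim): «continuum YM on T⁴ ⇐
BetaPertH ∧ nine spine estimates (0/9 proved); BetaPertH ⇐ (D1) ∧ (D4) ∧ CAP+tail; G-an2-4 gates asym, D1 and NE2/3/4.»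

WHAT THIS IS FOR.  The owner's sub-row Δ1 (`Support/DirichletFreeTower`, t4-ne2-p1 gen 11) types the Ω-restricted `U = 1` free tower
and displays ONE wall, the injected two-level law `hinj` of the compressed (Dirichlet) operators ([Balaban1985BackgroundPropagators]
p. 394 «Δ′_a↾Ω₀ = Ω₀Δ′_aΩ₀»).  The gan24-p2 lineage (`Beta/GAN24/DirichletBox*`) reduces `hinj` for the scalar model to ONE region-specific
input: a bound on the second differences `∂′_μᴴ∂′_μ v` of the zero-extended fine Dirichlet solution `v` (their (C-glob) pairing bound
`|⟨v, (J₀Δ − Δ′J₀)u⟩| ≤ (2/N)·Σ_μ ‖∂_μu‖·‖∂′_μᴴ∂′_μ v‖`), and proves the discrete `H²` bound (constant `1`) on CORNER-FREE regions — which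
FAILS uniformly in the spacing at every re-entrant edge.  THIS FILE proves a WEAKER second-difference bound that needs NO convexity:

  **`nsq (∂_μ∂_μ z) ≤ 8‖c‖ · √(2E(z) + 2d‖c‖²ℓ₁²‖z‖²) · ( √(Σ_{x∈Ω}|(Δz)(x)|²) + Σ_ν (2‖c‖ℓ₁‖∂_νz‖ + ‖c‖²ℓ₂‖z‖) )`**

for EVERY lattice field `z` supported in `Ω` (`E` = Dirichlet energy, `c` = the lattice factor `η⁻¹`), PROVIDED an ADMISSIBLE μ-CUTOFF
`ψ` exists (hypothesis STRUCTURE `AdmissibleCutoff Ω μ ψ ℓ₁ ℓ₂` on data: `0 ≤ ψ ≤ 1`, first differences `≤ ℓ₁`, pure second differences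
`≤ ℓ₂`, `ψ = 0` on the sites of `Ω` whose `−μ` neighbour is outside, `ψ = 1` on those whose `+μ` neighbour is outside).  With `ℓ₁ ~ 1/c`,
`ℓ₂ ~ 1/c²` (cutoffs varying on the UNIT scale; constructed for every LOCALLY MONOTONE union of unit blocks in module (II)
`DirichletMonotoneCutoff`) the right side is `O(c)·‖datum‖²` for a Dirichlet solution — ONE power of `c` worse than `H²`, i.e. exactly
`∇z ∈ B^{1/2}_{2,∞}` — and fed into (C-glob) it yields the two-level law at the GEOMETRIC rate `√R/√N` (module (III)
`DirichletMonotoneTwoLevel`), consumable by the row-B8 general-rate ENDs (`towerLimitRate_dirichlet_of_injected` at `θ = L^{−1/2}`).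

THE METHOD (Savaré's admissible one-sided translations, made discrete; [folklore] — nothing printed is a hypothesis).  For a lattice
translation `T = T_{±e_μ}` (which commutes with `Δ = Σ_ν ∂_νᴴ∂_ν` and preserves `ℓ²`) and ANY field `w`, the pointwise identity
`|a − b|² = |a|² + |b|² − 2Re(āb)` summed over the torus gives §2 `‖∂_ν(Tw − w)‖² = −2Re⟨∂_ν(Tw − w), ∂_νw⟩`, hence
`Σ_ν‖∂_ν(Tw − w)‖² = −2Re⟨Tw − w, Δw⟩`.  If `Tw − w` is SUPPORTED IN `Ω` (admissibility) then `Δw` may be replaced by anything that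
agrees with it ON `Ω` (§3), so `Σ_ν‖∂_ν(Tw − w)‖² ≤ 2‖Tw − w‖·‖r‖ ≤ 2‖c‖⁻¹‖∂_μw‖·‖r‖` — one full power of the spacing gained, with no
second difference of `w` on the right.  Admissibility is arranged by the cutoff: `w⁺ = ψz` with `T_{+e_μ}`, `w⁻ = (1 − ψ)z` with
`T_{−e_μ}` (§5–§6); the commutator `Δ(ψz) − ψΔz` costs only `‖∇z‖ + ‖z‖` because `ψ` is smooth on the unit scale (§5, the displayed
product-rule identity with first and PURE second differences of `ψ` only).

ABSOLUTE RULE (cell, verbatim): «No internally-minted statement may enter as a cited fact. Every hypothesis is either kernel-proved in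
this package or a verbatim quotation of a PUBLISHED theorem with page reference. The manuscript(s) under audit are NOT citable for
their own disputed steps — they are the thing under adjudication; programme-internal (2001/route/tribunal) claims are never citable.»
Everything below is [folklore] finite lattice calculus on the tree's typed torus objects (`B5Action121.sdiff/LapS`,
`ScalarBlockPoincare.transS`); no `def … : Prop` fact; the only predicate is the parametrised hypothesis SHAPE `AdmissibleCutoff`.
NOT CLAIMED: that every region admits such cutoffs (module (II) gives a class and names the excluded vertex configurations); anything
about the VECTOR operator `calDalev` with its non-local Landau term (the owner's carriers; R20 (a)(i): the scalar model is the first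
target); rate `L^{−k}`; NE2; NE3; «not in print; our proof».
-/

noncomputable section

open scoped BigOperators ComplexConjugate Matrix
open Finset

namespace Summit.QuantumFields.BalabanUV.T4Continuum.DirichletDirectionalBesov

open Literature.MathematicalPhysics.QuantumFieldTheory.Balaban1983to89.B5Prop11Plancherel (Tor unitVec)
open Literature.MathematicalPhysics.QuantumFieldTheory.Balaban1983to89.B5Action121 (sdiff LapS sdiff_mulVec LapS_mulVec)
open Literature.MathematicalPhysics.QuantumFieldTheory.Balaban1983to89.B5Prop11Lower (nsq nsq_nonneg star_dotProduct_self
  norm_star_dotProduct_le)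
open Summit.QuantumFields.BalabanUV.T4Continuum.ScalarBlockPoincare (nsq_add_le nsq_smul transS nsq_transS sdiff_mulVec_eq)

variable {d : ℕ}

/-! ## §1 `ℓ²` toolkit: the norm `√nsq`, pointwise multipliers, restricted masses -/

section VecTools

variable {m : Type*} [Fintype m]

/-- `√nsq` is the Euclidean norm of the `WithLp 2` copy. [folklore] -/
theorem sqrt_nsq_eq_norm (u : m → ℂ) : Real.sqrt (nsq u) = ‖(WithLp.toLp 2 u : EuclideanSpace ℂ m)‖ := by
  rw [EuclideanSpace.norm_eq]; rfl

/-- triangle inequality `‖f + g‖ ≤ ‖f‖ + ‖g‖` for `√nsq`. [folklore] -/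
theorem sqrt_nsq_add_le (f g : m → ℂ) : Real.sqrt (nsq (f + g)) ≤ Real.sqrt (nsq f) + Real.sqrt (nsq g) := by
  rw [sqrt_nsq_eq_norm, sqrt_nsq_eq_norm, sqrt_nsq_eq_norm, WithLp.toLp_add]
  exact norm_add_le _ _

/-- `‖−f‖ = ‖f‖` for `nsq`. [folklore] -/
theorem nsq_neg (f : m → ℂ) : nsq (-f) = nsq f := by
  unfold nsq; exact Finset.sum_congr rfl fun x _ => by rw [Pi.neg_apply, norm_neg]

/-- `‖f − g‖ ≤ ‖f‖ + ‖g‖` for `√nsq`. [folklore] -/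
theorem sqrt_nsq_sub_le (f g : m → ℂ) : Real.sqrt (nsq (f - g)) ≤ Real.sqrt (nsq f) + Real.sqrt (nsq g) := by
  rw [sub_eq_add_neg]
  refine (sqrt_nsq_add_le f (-g)).trans ?_
  rw [nsq_neg]

/-- finite triangle inequality `‖Σ_i g_i‖ ≤ Σ_i ‖g_i‖` for `√nsq`. [folklore] -/
theorem sqrt_nsq_sum_le {σ : Type*} (s : Finset σ) (g : σ → m → ℂ) :
    Real.sqrt (nsq (∑ i ∈ s, g i)) ≤ ∑ i ∈ s, Real.sqrt (nsq (g i)) := by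
  classical
  induction s using Finset.induction_on with
  | empty => simp [nsq]
  | insert a s ha ih =>
    rw [Finset.sum_insert ha, Finset.sum_insert ha]
    exact (sqrt_nsq_add_le _ _).trans (by linarith)

/-- pointwise domination `|f| ≤ |g|` gives `nsq f ≤ nsq g`. [folklore] -/
theorem nsq_mono {f g : m → ℂ} (h : ∀ x, ‖f x‖ ≤ ‖g x‖) : nsq f ≤ nsq g :=
  Finset.sum_le_sum fun x _ => pow_le_pow_left₀ (norm_nonneg _) (h x) 2

/-- and `√nsq f ≤ √nsq g`. [folklore] -/
theorem sqrt_nsq_mono {f g : m → ℂ} (h : ∀ x, ‖f x‖ ≤ ‖g x‖) : Real.sqrt (nsq f) ≤ Real.sqrt (nsq g) :=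
  Real.sqrt_le_sqrt (nsq_mono h)

/-- a pointwise multiplier bounded by `ℓ`: `nsq (a·f) ≤ ℓ²·nsq f`. [folklore] -/
theorem nsq_mul_le {a : m → ℂ} {ℓ : ℝ} (ha : ∀ x, ‖a x‖ ≤ ℓ) (f : m → ℂ) :
    nsq (fun x => a x * f x) ≤ ℓ ^ 2 * nsq f := by
  unfold nsq; rw [Finset.mul_sum]
  refine Finset.sum_le_sum fun x _ => ?_
  rw [norm_mul, mul_pow]
  exact mul_le_mul_of_nonneg_right (pow_le_pow_left₀ (norm_nonneg _) (ha x) 2) (sq_nonneg _)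

/-- and `√nsq (a·f) ≤ ℓ·√nsq f` for `ℓ ≥ 0`. [folklore] -/
theorem sqrt_nsq_mul_le {a : m → ℂ} {ℓ : ℝ} (hℓ : 0 ≤ ℓ) (ha : ∀ x, ‖a x‖ ≤ ℓ) (f : m → ℂ) :
    Real.sqrt (nsq (fun x => a x * f x)) ≤ ℓ * Real.sqrt (nsq f) := by
  calc Real.sqrt (nsq (fun x => a x * f x)) ≤ Real.sqrt (ℓ ^ 2 * nsq f) := Real.sqrt_le_sqrt (nsq_mul_le ha f)
    _ = ℓ * Real.sqrt (nsq f) := by rw [Real.sqrt_mul (sq_nonneg _), Real.sqrt_sq hℓ]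

/-- `√nsq (c • f) = ‖c‖·√nsq f`. [folklore] -/
theorem sqrt_nsq_smul (c : ℂ) (f : m → ℂ) : Real.sqrt (nsq (c • f)) = ‖c‖ * Real.sqrt (nsq f) := by
  rw [nsq_smul, Real.sqrt_mul (sq_nonneg _), Real.sqrt_sq (norm_nonneg _)]

/-- the restricted mass `Σ_{x : Ω x} |f x|²` (the `Ω`-part of `nsq f`). [folklore] -/
def nsqOn (Ω : m → Prop) [DecidablePred Ω] (f : m → ℂ) : ℝ := ∑ a : {x // Ω x}, ‖f a‖ ^ 2

/-- the indicator-restricted field `1_Ω·f`. [folklore] -/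
def restrictTo (Ω : m → Prop) [DecidablePred Ω] (f : m → ℂ) : m → ℂ := fun x => if Ω x then f x else 0

/-- `nsq (1_Ω f) = Σ_{x : Ω x} |f x|²`. [folklore] -/
theorem nsq_restrictTo (Ω : m → Prop) [DecidablePred Ω] (f : m → ℂ) : nsq (restrictTo Ω f) = nsqOn Ω f := by
  classical
  unfold nsq nsqOn restrictTo
  rw [← Fintype.sum_subtype_add_sum_subtype Ω (fun x => ‖(if Ω x then f x else 0)‖ ^ 2)]
  have h1 : ∑ a : {x // Ω x}, ‖(if Ω (a : m) then f a else 0)‖ ^ 2 = ∑ a : {x // Ω x}, ‖f a‖ ^ 2 :=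
    Finset.sum_congr rfl fun a _ => by rw [if_pos a.2]
  have h2 : ∑ a : {x // ¬ Ω x}, ‖(if Ω (a : m) then f a else 0)‖ ^ 2 = 0 :=
    Finset.sum_eq_zero fun a _ => by rw [if_neg a.2, norm_zero]; ring
  rw [h1, h2, add_zero]

/-- `nsqOn Ω f ≥ 0`. [folklore] -/
theorem nsqOn_nonneg (Ω : m → Prop) [DecidablePred Ω] (f : m → ℂ) : 0 ≤ nsqOn Ω f :=
  Finset.sum_nonneg fun _ _ => by positivity

omit [Fintype m] in
/-- `|1_Ω f| ≤ |f|` pointwise. [folklore] -/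
theorem norm_restrictTo_le (Ω : m → Prop) [DecidablePred Ω] (f : m → ℂ) (x : m) : ‖restrictTo Ω f x‖ ≤ ‖f x‖ := by
  unfold restrictTo; split_ifs
  · exact le_rfl
  · rw [norm_zero]; exact norm_nonneg _

/-- `|p − q|² = |p|² + |q|² − 2Re(p̄q)`. [folklore] -/
theorem norm_sub_sq_eq (p q : ℂ) : ‖p - q‖ ^ 2 = ‖p‖ ^ 2 + ‖q‖ ^ 2 - 2 * (conj p * q).re := by
  rw [← Complex.normSq_eq_norm_sq, ← Complex.normSq_eq_norm_sq, ← Complex.normSq_eq_norm_sq, Complex.normSq_sub]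
  congr 2
  rw [← Complex.conj_re (p * conj q), map_mul, Complex.conj_conj]

/-- `star f ⬝ᵥ g = Σ_x f̄(x) g(x)`. [folklore] -/
theorem star_dotProduct_eq_sum (f g : m → ℂ) : star f ⬝ᵥ g = ∑ x, conj (f x) * g x := rfl

end VecTools

/-! ## §2 The one-sided Nirenberg identity -/

section Torus

variable (N : Fin d → ℕ) [hN : ∀ μ, NeZero (N μ)]

/-- differences commute with translations: `∂_ν(T_v w) = T_v(∂_ν w)`. [folklore] -/
theorem sdiff_transS (c : ℂ) (ν : Fin d) (v : Tor N) (w : Tor N → ℂ) :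
    sdiff N c ν *ᵥ transS N v w = transS N v (sdiff N c ν *ᵥ w) := by
  funext x
  simp only [sdiff_mulVec, transS, add_right_comm x v (unitVec N ν)]

/-- differences are linear: `∂_ν(f − g) = ∂_νf − ∂_νg`. [folklore] -/
theorem sdiff_mulVec_sub (c : ℂ) (ν : Fin d) (f g : Tor N → ℂ) :
    sdiff N c ν *ᵥ (f - g) = sdiff N c ν *ᵥ f - sdiff N c ν *ᵥ g := Matrix.mulVec_sub _ _ _

/-- the dot product is translation invariant: `⟨T_v f, T_v g⟩ = ⟨f, g⟩`. [folklore] -/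
theorem star_transS_dotProduct_transS (v : Tor N) (f g : Tor N → ℂ) :
    star (transS N v f) ⬝ᵥ transS N v g = star f ⬝ᵥ g := by
  simp only [star_dotProduct_eq_sum, transS]
  exact Fintype.sum_equiv (Equiv.addRight v) _ _ fun x => rfl

/-- **THE ONE-SIDED NIRENBERG IDENTITY, one direction**: for every translation `T_v` and every field `w`,
`‖∂_ν(T_vw − w)‖² = −2Re⟨∂_ν(T_vw − w), ∂_νw⟩` (from `|a − b|² = |a|² + |b|² − 2Re(āb)` and `Σ_x|(∂_νw)(x + v)|² = Σ_x|(∂_νw)(x)|²`).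
[folklore] -/
theorem nsq_sdiff_transS_sub (c : ℂ) (ν : Fin d) (v : Tor N) (w : Tor N → ℂ) :
    nsq (sdiff N c ν *ᵥ (transS N v w - w))
      = -2 * (star (sdiff N c ν *ᵥ (transS N v w - w)) ⬝ᵥ (sdiff N c ν *ᵥ w)).re := by
  set b : Tor N → ℂ := sdiff N c ν *ᵥ w with hb
  have ha : sdiff N c ν *ᵥ (transS N v w - w) = transS N v b - b := by
    rw [sdiff_mulVec_sub, sdiff_transS]
  rw [ha]
  have hT : nsq (transS N v b) = nsq b := nsq_transS N v b
  -- expand `|a − b|²` pointwise and sum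
  have h1 : nsq (transS N v b - b) = nsq (transS N v b) + nsq b - 2 * (star (transS N v b) ⬝ᵥ b).re := by
    unfold nsq
    rw [star_dotProduct_eq_sum, Complex.re_sum, Finset.mul_sum, ← Finset.sum_add_distrib, ← Finset.sum_sub_distrib]
    exact Finset.sum_congr rfl fun x _ => by rw [Pi.sub_apply, norm_sub_sq_eq]
  have h2 : star (transS N v b - b) ⬝ᵥ b = star (transS N v b) ⬝ᵥ b - ((nsq b : ℝ) : ℂ) := by
    rw [star_sub, sub_dotProduct, star_dotProduct_self]
  rw [h1, h2, Complex.sub_re, Complex.ofReal_re, hT]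
  ring

/-- `⟨φ, ∂_νᴴ∂_ν w⟩ = ⟨∂_νφ, ∂_νw⟩` (polarised Gram identity). [folklore] -/
theorem star_dotProduct_gram (X : Matrix (Tor N) (Tor N) ℂ) (φ w : Tor N → ℂ) :
    star φ ⬝ᵥ ((Xᴴ * X) *ᵥ w) = star (X *ᵥ φ) ⬝ᵥ (X *ᵥ w) := by
  rw [← Matrix.mulVec_mulVec, Matrix.dotProduct_mulVec, Matrix.vecMul_conjTranspose, star_star]

/-- `⟨φ, Δw⟩ = Σ_ν ⟨∂_νφ, ∂_νw⟩`. [folklore] -/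
theorem star_dotProduct_LapS (c : ℂ) (φ w : Tor N → ℂ) :
    star φ ⬝ᵥ (LapS N c *ᵥ w) = ∑ ν, star (sdiff N c ν *ᵥ φ) ⬝ᵥ (sdiff N c ν *ᵥ w) := by
  rw [LapS, Matrix.sum_mulVec, dotProduct_sum]
  exact Finset.sum_congr rfl fun ν _ => star_dotProduct_gram N _ φ w

/-- **THE ONE-SIDED NIRENBERG IDENTITY**: `Σ_ν ‖∂_ν(T_vw − w)‖² = −2Re⟨T_vw − w, Δw⟩` for every translation `T_v` and every `w`
(no boundary condition, no support hypothesis — translations commute with `Δ` and preserve `ℓ²`). [folklore] -/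
theorem energy_transS_sub_eq (c : ℂ) (v : Tor N) (w : Tor N → ℂ) :
    ∑ ν, nsq (sdiff N c ν *ᵥ (transS N v w - w)) = -2 * (star (transS N v w - w) ⬝ᵥ (LapS N c *ᵥ w)).re := by
  rw [star_dotProduct_LapS, Complex.re_sum, Finset.mul_sum]
  exact Finset.sum_congr rfl fun ν _ => nsq_sdiff_transS_sub N c ν v w

/-! ## §3 Admissible translations: the gain of one power of the spacing -/

/-- **ADMISSIBLE TRANSLATION STEP**: if `T_vw − w` is supported in `Ω` and `r` agrees with `Δw` ON `Ω`, then
`Σ_ν ‖∂_ν(T_vw − w)‖² ≤ 2·‖T_vw − w‖·‖r‖`. [folklore] -/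
theorem energy_transS_sub_le {Ω : Tor N → Prop} (c : ℂ) (v : Tor N) (w r : Tor N → ℂ)
    (hadm : ∀ x, ¬ Ω x → (transS N v w - w) x = 0) (hr : ∀ x, Ω x → r x = (LapS N c *ᵥ w) x) :
    ∑ ν, nsq (sdiff N c ν *ᵥ (transS N v w - w))
      ≤ 2 * (Real.sqrt (nsq (transS N v w - w)) * Real.sqrt (nsq r)) := by
  have hreplace : star (transS N v w - w) ⬝ᵥ (LapS N c *ᵥ w) = star (transS N v w - w) ⬝ᵥ r := by
    simp only [star_dotProduct_eq_sum]
    refine Finset.sum_congr rfl fun x _ => ?_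
    by_cases hx : Ω x
    · rw [hr x hx]
    · rw [hadm x hx, map_zero, zero_mul, zero_mul]
  rw [energy_transS_sub_eq, hreplace]
  have h := norm_star_dotProduct_le (transS N v w - w) r
  have h2 := Complex.abs_re_le_norm (star (transS N v w - w) ⬝ᵥ r)
  have h3 := neg_abs_le (star (transS N v w - w) ⬝ᵥ r).re
  linarith

/-- the one-step translate is a difference: `T_{e_μ}w − w = c⁻¹·∂_μw` (`c ≠ 0`). [folklore] -/
theorem transS_unitVec_sub (c : ℂ) (hc : c ≠ 0) (μ : Fin d) (w : Tor N → ℂ) :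
    transS N (unitVec N μ) w - w = c⁻¹ • (sdiff N c μ *ᵥ w) := by
  rw [sdiff_mulVec_eq, smul_smul, inv_mul_cancel₀ hc, one_smul]

omit hN in
/-- the backward translate: `T_{−e_μ}w − w = −T_{−e_μ}(T_{e_μ}w − w)`. [folklore] -/
theorem transS_neg_unitVec_sub (μ : Fin d) (w : Tor N → ℂ) :
    transS N (-unitVec N μ) w - w = -transS N (-unitVec N μ) (transS N (unitVec N μ) w - w) := by
  funext x
  simp only [transS, Pi.sub_apply, Pi.neg_apply, neg_sub, neg_add_cancel_right]

/-- `‖T_{±e_μ}w − w‖² = ‖c‖⁻²·‖∂_μw‖²`. [folklore] -/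
theorem nsq_transS_sub_eq (c : ℂ) (hc : c ≠ 0) (μ : Fin d) {v : Tor N} (hv : v = unitVec N μ ∨ v = -unitVec N μ)
    (w : Tor N → ℂ) : nsq (transS N v w - w) = ‖c‖⁻¹ ^ 2 * nsq (sdiff N c μ *ᵥ w) := by
  rcases hv with rfl | rfl
  · rw [transS_unitVec_sub N c hc, nsq_smul, norm_inv]
  · rw [transS_neg_unitVec_sub, nsq_neg, nsq_transS, transS_unitVec_sub N c hc, nsq_smul, norm_inv]

/-- `‖∂_μ(T_{±e_μ}w − w)‖² = ‖c‖⁻²·‖∂_μ∂_μw‖²`. [folklore] -/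
theorem nsq_sdiff_transS_sub_eq (c : ℂ) (hc : c ≠ 0) (μ : Fin d) {v : Tor N} (hv : v = unitVec N μ ∨ v = -unitVec N μ)
    (w : Tor N → ℂ) :
    nsq (sdiff N c μ *ᵥ (transS N v w - w)) = ‖c‖⁻¹ ^ 2 * nsq (sdiff N c μ *ᵥ (sdiff N c μ *ᵥ w)) := by
  rcases hv with rfl | rfl
  · rw [transS_unitVec_sub N c hc, Matrix.mulVec_smul, nsq_smul, norm_inv]
  · rw [transS_neg_unitVec_sub, Matrix.mulVec_neg, nsq_neg, sdiff_transS, nsq_transS, transS_unitVec_sub N c hc,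
      Matrix.mulVec_smul, nsq_smul, norm_inv]

/-- **THE MAIN LEMMA (one admissible piece)**: if `T_vw − w` (`v = ±e_μ`) is supported in `Ω` and `r = Δw` on `Ω`, then
`‖∂_μ∂_μ w‖² ≤ 2‖c‖·√(Σ_ν‖∂_νw‖²)·‖r‖` — ONE power of `c` against the datum, no second difference of `w` on the right. [folklore] -/
theorem nsq_sdiff_sdiff_le_of_admissible {Ω : Tor N → Prop} (c : ℂ) (hc : c ≠ 0) (μ : Fin d) {v : Tor N}
    (hv : v = unitVec N μ ∨ v = -unitVec N μ) (w r : Tor N → ℂ)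
    (hadm : ∀ x, ¬ Ω x → (transS N v w - w) x = 0) (hr : ∀ x, Ω x → r x = (LapS N c *ᵥ w) x) :
    nsq (sdiff N c μ *ᵥ (sdiff N c μ *ᵥ w))
      ≤ 2 * ‖c‖ * Real.sqrt (∑ ν, nsq (sdiff N c ν *ᵥ w)) * Real.sqrt (nsq r) := by
  have hc0 : 0 < ‖c‖ := norm_pos_iff.mpr hc
  have hE := energy_transS_sub_le N c v w r hadm hr
  -- `‖c‖⁻² ‖∂_μ∂_μw‖² = ‖∂_μ φ‖² ≤ Σ_ν ‖∂_ν φ‖² ≤ 2 ‖φ‖ ‖r‖`, `‖φ‖ = ‖c‖⁻¹ ‖∂_μ w‖ ≤ ‖c‖⁻¹ √E`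
  have h1 : ‖c‖⁻¹ ^ 2 * nsq (sdiff N c μ *ᵥ (sdiff N c μ *ᵥ w)) ≤ ∑ ν, nsq (sdiff N c ν *ᵥ (transS N v w - w)) := by
    rw [← nsq_sdiff_transS_sub_eq N c hc μ hv]
    exact Finset.single_le_sum (f := fun ν => nsq (sdiff N c ν *ᵥ (transS N v w - w))) (fun _ _ => nsq_nonneg _)
      (Finset.mem_univ μ)
  have h2 : Real.sqrt (nsq (transS N v w - w)) ≤ ‖c‖⁻¹ * Real.sqrt (∑ ν, nsq (sdiff N c ν *ᵥ w)) := by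
    rw [nsq_transS_sub_eq N c hc μ hv, Real.sqrt_mul (sq_nonneg _), Real.sqrt_sq (inv_nonneg.mpr hc0.le)]
    exact mul_le_mul_of_nonneg_left (Real.sqrt_le_sqrt (Finset.single_le_sum
      (f := fun ν => nsq (sdiff N c ν *ᵥ w)) (fun _ _ => nsq_nonneg _) (Finset.mem_univ μ))) (inv_nonneg.mpr hc0.le)
  have hr0 : 0 ≤ Real.sqrt (nsq r) := Real.sqrt_nonneg _
  have h3 : ‖c‖⁻¹ ^ 2 * nsq (sdiff N c μ *ᵥ (sdiff N c μ *ᵥ w))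
      ≤ 2 * (‖c‖⁻¹ * Real.sqrt (∑ ν, nsq (sdiff N c ν *ᵥ w)) * Real.sqrt (nsq r)) :=
    (h1.trans hE).trans (by nlinarith [h2, hr0])
  have h4 := mul_le_mul_of_nonneg_left h3 (sq_nonneg ‖c‖)
  have hcc : ‖c‖ ^ 2 * ‖c‖⁻¹ ^ 2 = 1 := by field_simp
  calc nsq (sdiff N c μ *ᵥ (sdiff N c μ *ᵥ w)) = ‖c‖ ^ 2 * (‖c‖⁻¹ ^ 2 * nsq (sdiff N c μ *ᵥ (sdiff N c μ *ᵥ w))) := by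
        rw [← mul_assoc, hcc, one_mul]
    _ ≤ ‖c‖ ^ 2 * (2 * (‖c‖⁻¹ * Real.sqrt (∑ ν, nsq (sdiff N c ν *ᵥ w)) * Real.sqrt (nsq r))) := h4
    _ = 2 * ‖c‖ * Real.sqrt (∑ ν, nsq (sdiff N c ν *ᵥ w)) * Real.sqrt (nsq r) := by field_simp

end Torus

end Summit.QuantumFields.BalabanUV.T4Continuum.DirichletDirectionalBesov

end
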